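import Mathlib
import Summits.Ventures.HodgeRepro.Tier4.Line1.RTFSetting
import Summits.Ventures.HodgeRepro.Tier4.Line4.L1Class
import Summits.Ventures.HodgeRepro.Tier4.Line4.TailAssembly
import Summits.Ventures.HodgeRepro.Tier4.Line4.TailAssemblySupport

/-!
# Tier4/Line4/TailWrapper — C-L4-TAIL's assembly BOUND TO THE DISPLAYS OF RECORD: `L1Class.TailDominatedFrom` and
`L1Class.LevelTailDominated` from the five displays (the lead's (R-25) word, S15032)

Blind re-derivation cell `pub-hodge-repro`, Tier 4 (README §9–§10), seat t4-L1-p4 (gen 4), LINE L4 cut (c).  Target tree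
path `lean/Summits/Ventures/HodgeRepro/Tier4/Line4/TailWrapper.lean`.  Imports plan-4's L1Class (p699130:
`TailDominated`, `TailDominatedFrom`, `prodFn`, `LevelTailDominated`) and this seat's TailAssemblySupport
(`exists_tail_lt_of_support_count`).  0 print.

WHAT IS PROVED (one-line wrappers, the binder order of record):
* `tailDominatedFrom_of_support_count`: `L1Class.TailDominatedFrom S χ χ' o₀ f` from the displays (S1) sparsity
  (`hsparse`, scale `g → ∞`), (S2′) count on the support uniform in the level (`hcount`), (S3) decay at rate `β + δ`
  (`hdecay`), (S4) main term (`hmain`) — `TailDominated` is exactly the conclusion of `exists_tail_lt_of_support_count`;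
* `tailDominatedFrom_of_support_count'`: the same with the sparsity only from a level `N₂` on (plan-4's (S1) shape);
* `levelTailDominated_of_support_count` / `levelTailDominated_of_support_count'`: `L1Class.LevelTailDominated W S χ χ' o₀
  finf ffin f₂` for the level family `f N := S.conv (prodFn W finf (ffin N)) (f₂ N)` — C-L4-TAIL of record, modulo the
  five displays.  Nothing here says anything about the status of the Hodge conjecture for CM abelian varieties, which
  is NOT proved (HC_CM is NOT proved by anyone in this repository).
-/

set_option autoImplicit false

noncomputable section

namespace Summit.Ventures.HodgeRepro.Tier4.Line4

open Filter Topology Summit.Ventures.HodgeRepro.Tier4.Common Summit.Ventures.HodgeRepro.Tier4.Line1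
  Summit.Ventures.HodgeRepro.Tier4.Line1.RTF

section Abstract

variable {G : Type} [Group G] [TopologicalSpace G] [MeasurableSpace G] (S : Setting G)

/-- **`TailDominatedFrom` from the displays** (S1) sparsity, (S2′) count on the support, (S3) decay, (S4) main term. -/
theorem tailDominatedFrom_of_support_count (χ : S.T → ℂ) (χ' : S.T' → ℂ) (o₀ : S.Orbit) (f : ℕ → G → ℂ)
    (d : S.Orbit → ℝ) (g : ℕ → ℝ) (hd : ∀ o, 0 ≤ d o) {C C' α β δ : ℝ} (hC : 0 ≤ C) (hC' : 0 ≤ C')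
    (hαβ : α < β) (hβ : 0 ≤ β) (hδ : 0 < δ) (hg : Tendsto g atTop atTop)
    (hcount : ∀ (N : ℕ) (T : ℝ), ∃ s : Finset S.Orbit,
      (∀ o, S.orbital χ χ' o (f N) ≠ 0 → d o ≤ T → o ∈ s) ∧ (s.card : ℝ) ≤ C' * Real.exp (α * T))
    (hdecay : ∀ N o, o ≠ o₀ → ‖S.orbital χ χ' o (f N)‖ ≤ C * Real.exp (-((β + δ) * d o)))
    (hsparse : ∀ N o, o ≠ o₀ → S.orbital χ χ' o (f N) ≠ 0 → g N ≤ d o)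
    (hmain : ∃ m : ℝ, 0 < m ∧ ∃ N₁ : ℕ, ∀ N ≥ N₁, m ≤ ‖S.orbital χ χ' o₀ (f N)‖) :
    L1Class.TailDominatedFrom S χ χ' o₀ f := by
  obtain ⟨N₀, hN₀⟩ := exists_tail_lt_of_support_count (fun N o => S.orbital χ χ' o (f N)) o₀ d g hd hC hC' hαβ
    hβ hδ hg hcount hdecay hsparse hmain
  exact ⟨N₀, fun N hN => ⟨(hN₀ N hN).1, (hN₀ N hN).2.1, (hN₀ N hN).2.2⟩⟩

/-- the same with the sparsity only from a level `N₂` on (plan-4's (S1) shape, S14998). -/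
theorem tailDominatedFrom_of_support_count' (χ : S.T → ℂ) (χ' : S.T' → ℂ) (o₀ : S.Orbit) (f : ℕ → G → ℂ)
    (d : S.Orbit → ℝ) (g : ℕ → ℝ) (hd : ∀ o, 0 ≤ d o) {C C' α β δ : ℝ} (hC : 0 ≤ C) (hC' : 0 ≤ C')
    (hαβ : α < β) (hβ : 0 ≤ β) (hδ : 0 < δ) (hg : Tendsto g atTop atTop)
    (hcount : ∀ (N : ℕ) (T : ℝ), ∃ s : Finset S.Orbit,
      (∀ o, S.orbital χ χ' o (f N) ≠ 0 → d o ≤ T → o ∈ s) ∧ (s.card : ℝ) ≤ C' * Real.exp (α * T))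
    (hdecay : ∀ N o, o ≠ o₀ → ‖S.orbital χ χ' o (f N)‖ ≤ C * Real.exp (-((β + δ) * d o)))
    {N₂ : ℕ} (hsparse : ∀ N, N₂ < N → ∀ o, o ≠ o₀ → S.orbital χ χ' o (f N) ≠ 0 → g N ≤ d o)
    (hmain : ∃ m : ℝ, 0 < m ∧ ∃ N₁ : ℕ, ∀ N ≥ N₁, m ≤ ‖S.orbital χ χ' o₀ (f N)‖) :
    L1Class.TailDominatedFrom S χ χ' o₀ f := by
  classical
  let g' : ℕ → ℝ := fun N => if N₂ < N then g N else 0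
  have hg' : Tendsto g' atTop atTop := by
    refine hg.congr' ?_
    filter_upwards [Filter.eventually_gt_atTop N₂] with N hN
    simp only [g', if_pos hN]
  refine tailDominatedFrom_of_support_count S χ χ' o₀ f d g' hd hC hC' hαβ hβ hδ hg' hcount hdecay
    (fun N o ho hne => ?_) hmain
  by_cases hN : N₂ < N
  · simp only [g', if_pos hN]
    exact hsparse N hN o ho hne
  · simp only [g', if_neg hN]
    exact hd o

end Abstract

section Arch

open NumberField

variable {k : Type} [Field k] [NumberField k] (W : PlaneData k) [MeasurableSpace (GA W)]

/-- **C-L4-TAIL of record**: `LevelTailDominated` for the level family `N ↦ prodFn finf (ffin N) ⋆ f₂ N` from the five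
displays on that family. -/
theorem levelTailDominated_of_support_count (S : Setting (GA W)) (χ : S.T → ℂ) (χ' : S.T' → ℂ) (o₀ : S.Orbit)
    (finf : GA W → ℂ) (ffin f₂ : ℕ → GA W → ℂ) (d : S.Orbit → ℝ) (g : ℕ → ℝ) (hd : ∀ o, 0 ≤ d o)
    {C C' α β δ : ℝ} (hC : 0 ≤ C) (hC' : 0 ≤ C') (hαβ : α < β) (hβ : 0 ≤ β) (hδ : 0 < δ)
    (hg : Tendsto g atTop atTop)
    (hcount : ∀ (N : ℕ) (T : ℝ), ∃ s : Finset S.Orbit,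
      (∀ o, S.orbital χ χ' o (S.conv (L1Class.prodFn W finf (ffin N)) (f₂ N)) ≠ 0 → d o ≤ T → o ∈ s) ∧
        (s.card : ℝ) ≤ C' * Real.exp (α * T))
    (hdecay : ∀ N o, o ≠ o₀ → ‖S.orbital χ χ' o (S.conv (L1Class.prodFn W finf (ffin N)) (f₂ N))‖ ≤
      C * Real.exp (-((β + δ) * d o)))
    (hsparse : ∀ N o, o ≠ o₀ → S.orbital χ χ' o (S.conv (L1Class.prodFn W finf (ffin N)) (f₂ N)) ≠ 0 →
      g N ≤ d o)
    (hmain : ∃ m : ℝ, 0 < m ∧ ∃ N₁ : ℕ, ∀ N ≥ N₁,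
      m ≤ ‖S.orbital χ χ' o₀ (S.conv (L1Class.prodFn W finf (ffin N)) (f₂ N))‖) :
    L1Class.LevelTailDominated W S χ χ' o₀ finf ffin f₂ :=
  tailDominatedFrom_of_support_count S χ χ' o₀ (fun N => S.conv (L1Class.prodFn W finf (ffin N)) (f₂ N)) d g hd
    hC hC' hαβ hβ hδ hg hcount hdecay hsparse hmain

/-- C-L4-TAIL of record with the sparsity only from a level `N₂` on. -/
theorem levelTailDominated_of_support_count' (S : Setting (GA W)) (χ : S.T → ℂ) (χ' : S.T' → ℂ) (o₀ : S.Orbit)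
    (finf : GA W → ℂ) (ffin f₂ : ℕ → GA W → ℂ) (d : S.Orbit → ℝ) (g : ℕ → ℝ) (hd : ∀ o, 0 ≤ d o)
    {C C' α β δ : ℝ} (hC : 0 ≤ C) (hC' : 0 ≤ C') (hαβ : α < β) (hβ : 0 ≤ β) (hδ : 0 < δ)
    (hg : Tendsto g atTop atTop)
    (hcount : ∀ (N : ℕ) (T : ℝ), ∃ s : Finset S.Orbit,
      (∀ o, S.orbital χ χ' o (S.conv (L1Class.prodFn W finf (ffin N)) (f₂ N)) ≠ 0 → d o ≤ T → o ∈ s) ∧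
        (s.card : ℝ) ≤ C' * Real.exp (α * T))
    (hdecay : ∀ N o, o ≠ o₀ → ‖S.orbital χ χ' o (S.conv (L1Class.prodFn W finf (ffin N)) (f₂ N))‖ ≤
      C * Real.exp (-((β + δ) * d o)))
    {N₂ : ℕ} (hsparse : ∀ N, N₂ < N → ∀ o, o ≠ o₀ →
      S.orbital χ χ' o (S.conv (L1Class.prodFn W finf (ffin N)) (f₂ N)) ≠ 0 → g N ≤ d o)
    (hmain : ∃ m : ℝ, 0 < m ∧ ∃ N₁ : ℕ, ∀ N ≥ N₁,
      m ≤ ‖S.orbital χ χ' o₀ (S.conv (L1Class.prodFn W finf (ffin N)) (f₂ N))‖) :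
    L1Class.LevelTailDominated W S χ χ' o₀ finf ffin f₂ :=
  tailDominatedFrom_of_support_count' S χ χ' o₀ (fun N => S.conv (L1Class.prodFn W finf (ffin N)) (f₂ N)) d g hd
    hC hC' hαβ hβ hδ hg hcount hdecay hsparse hmain

end Arch

end Summit.Ventures.HodgeRepro.Tier4.Line4

end
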